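import Summits.ValiantsHypothesis.ValiantsHypothesis.Theorems.LacunarySymmetroidMatrixDescartesPivotTwoDirectionsBlockLaw

/-!
# `MatrixDescartes` census — the `(2,4)₁` cell with RANK-ONE letters: `Z₊ ≤ 8 = 2K` under an explicit angular condition (S)
# (the kill-seven / four-nomial argument; in the interleaving chamber (B) Descartes allows TEN)

HONEST FRAMING.  Object-search cell `pub-symmetroid`, seat `val-sym-mdr-p1` (generation 12); helper file `--supports` the crux item
stmt-ValiantsHypothesis-18050 (`Theses.LacunarySymmetroid.MatrixDescartes`, OPEN, on HOLD) with NO closure claim.  A partial answer, in the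
kernel, to the desk's question of record for the `m = 2` pivot column (R2312: «det J < 0, all four letters core ⇒ is Z₊ ≤ 8?», in
particular «all four letters RANK ONE and core ⇒ Z₊ ≤ 8?»).  Engine: `…PivotTwoDirectionsBlockLaw` (weighted Rolle, four-nomial lemma).

**THEOREM (`chamberB_rankOne_posRoots_le_eight`, real-parameter form `elevenNomial_chamberB_le_eight`).**  `F = X^e J + ∑ₖ wₖ X^{dₖ} vₖvₖᵀ`
(`k = 0..3`; two letters below the pivot and two above: `d₀ < d₁ < e < d₂ < d₃`; weights `w₀, w₁, w₃ > 0`; `J` ANY real `2 × 2` matrix)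
with letters `1` and `3` pairing negatively with `J` (`m(J,v₁), m(J,v₃) < 0` — in the hard cell all four do), ONE exponent condition
`d₀ + d₂ < e + d₁` (gap form `|b₁| − |b₂| > b₃`; it holds throughout the interleaving chamber (B) of val-sym-mdr-p1 g11's memo —
rates `b₁ < b₂ < 0 < b₃ < b₄`, `b₃ < |b₂|`, `|b₁| − |b₂| > b₃`, `|b₁| < b₄ < |b₁| + b₃`, the home of the EIGHT-root rank-two certificate
`…PivotTwoFourInterleaved`, Descartes bound `10`), and the ANGULAR CONDITION (S)
`|m(J,v₁)|·Δ₀₃²·Π_B·Π_C ≤ |m(J,v₃)|·Δ₀₁²·Π_A·Π_D` (`Δ_{kl} = det[v_k v_l]`; `Π_A, Π_B, Π_C, Π_D` the products of the distances from the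
surviving degrees `d₀+d₁, e+d₁, d₀+d₃, e+d₃` to the seven killed degrees, spelled out in the statement): then `det F` has AT MOST EIGHT
distinct positive roots.
PROOF: `det F` is an eleven-nomial (`det_rankOne_four`, `det_rankOne_four_sum`); kill the seven degrees `2e, e+d₀, e+d₂, d₀+d₂, d₁+d₂,
d₁+d₃, d₂+d₃` (`card_posRoots_le_kills`); the survivors `d₀+d₁, e+d₁, d₀+d₃, e+d₃` are two translated pairs (shift `e − d₀`), the
killed eleven-nomial is MINUS `A X^{d₀+d₁} − B X^{e+d₁} + C X^{d₀+d₃} − D X^{e+d₃}` with `B, D > 0`, and (S) is exactly the cross-ratio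
hypothesis `B·C ≤ A·D` of `card_posRoots_fourNomial_le_one` (the weights cancel): ≤ 1 survivor root, so `Z₊ ≤ 7 + 1 = 8`.

WHAT (S) MEANS AND WHAT IS NOT CLAIMED.  (S) fails only when letter `3` is nearly non-core (`m(J,v₃) → 0`) or letters `0, 1` nearly
parallel (`Δ₀₁ → 0`) relative to the chamber slacks.  LOCATED (this seat, exp/gen24b.py: a SOUND analytic classifier of kept four-sets;
angles up to `10⁻⁶` from the core boundary and near-parallel pairs included): (S) holds in ≈ 97 % of chamber-(B) samples and ≈ 92 % of
all samples with `d₀ + d₂ < e + d₁`; in EVERY one of 1 500 chamber-(B) samples either (S) or the analogous condition for the kept set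
`{e+d₀, d₀+d₃, e+d₁, d₁+d₃}` held, and over all exponent orders two kept sets covered every sample — so this method has not yet met a
rank-one `(2,4)₁` configuration that could carry nine roots.  The complementary theorems and a covering lemma «(S) ∨ (S′)» are NOT
in this file: the rank-one law `(2,4)₁ ≤ 8` is NOT claimed.  Rank-two letters add the four degrees `2dₖ` (fifteen-nomial; eleven kills)
and are out of reach of this count.  Nothing here bears on `MatrixDescartes` in its window, on `DoorA26` / `DoorA34`, registers /
credences, or `VP ≠ VNP`.

[folklore] The engine of `…PivotTwoDirectionsBlockLaw`; `2 × 2` determinant algebra.  No definitions, no named facts.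
-/

-- `Summit.ValiantsHypothesis.ValiantsHypothesis.…` repeats a component by the D-0017 layout
-- (single-conjunct summit), which the `dupNamespace` linter flags; the name is mandated.
set_option linter.dupNamespace false

namespace Summit.ValiantsHypothesis.ValiantsHypothesis.Theorems.LacunarySymmetroidMatrixDescartes.Pivot.TwoDirections.BlockLaw

open Polynomial Matrix Finset
open scoped BigOperators

/-- The eleven-term expansion of the determinant of a `2 × 2` pencil with FOUR RANK-ONE letters `wₖ X^{dₖ} vₖvₖᵀ`:
`det F = X^{2e} det J + ∑ₖ X^{e+dₖ} wₖ m(J,vₖ) + ∑_{k<l} X^{dₖ+d_l} wₖw_l Δ_{kl}²`. [folklore] -/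
theorem det_rankOne_four (e d₀ d₁ d₂ d₃ : ℕ) (J : Matrix (Fin 2) (Fin 2) ℝ) (v₀ v₁ v₂ v₃ : Fin 2 → ℝ) (w₀ w₁ w₂ w₃ : ℝ) :
    Matrix.det (((X : ℝ[X]) ^ e) • J.map Polynomial.C
        + (Polynomial.C w₀ * X ^ d₀) • (vecMulVec v₀ v₀).map Polynomial.C
        + (Polynomial.C w₁ * X ^ d₁) • (vecMulVec v₁ v₁).map Polynomial.C
        + (Polynomial.C w₂ * X ^ d₂) • (vecMulVec v₂ v₂).map Polynomial.C
        + (Polynomial.C w₃ * X ^ d₃) • (vecMulVec v₃ v₃).map Polynomial.C)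
      = Polynomial.C J.det * X ^ (2 * e)
        + Polynomial.C (w₀ * (J 0 0 * v₀ 1 ^ 2 + J 1 1 * v₀ 0 ^ 2 - (J 0 1 + J 1 0) * (v₀ 0 * v₀ 1))) * X ^ (e + d₀)
        + Polynomial.C (w₁ * (J 0 0 * v₁ 1 ^ 2 + J 1 1 * v₁ 0 ^ 2 - (J 0 1 + J 1 0) * (v₁ 0 * v₁ 1))) * X ^ (e + d₁)
        + Polynomial.C (w₂ * (J 0 0 * v₂ 1 ^ 2 + J 1 1 * v₂ 0 ^ 2 - (J 0 1 + J 1 0) * (v₂ 0 * v₂ 1))) * X ^ (e + d₂)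
        + Polynomial.C (w₃ * (J 0 0 * v₃ 1 ^ 2 + J 1 1 * v₃ 0 ^ 2 - (J 0 1 + J 1 0) * (v₃ 0 * v₃ 1))) * X ^ (e + d₃)
        + Polynomial.C (w₀ * w₁ * (v₀ 0 * v₁ 1 - v₀ 1 * v₁ 0) ^ 2) * X ^ (d₀ + d₁)
        + Polynomial.C (w₀ * w₂ * (v₀ 0 * v₂ 1 - v₀ 1 * v₂ 0) ^ 2) * X ^ (d₀ + d₂)
        + Polynomial.C (w₀ * w₃ * (v₀ 0 * v₃ 1 - v₀ 1 * v₃ 0) ^ 2) * X ^ (d₀ + d₃)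
        + Polynomial.C (w₁ * w₂ * (v₁ 0 * v₂ 1 - v₁ 1 * v₂ 0) ^ 2) * X ^ (d₁ + d₂)
        + Polynomial.C (w₁ * w₃ * (v₁ 0 * v₃ 1 - v₁ 1 * v₃ 0) ^ 2) * X ^ (d₁ + d₃)
        + Polynomial.C (w₂ * w₃ * (v₂ 0 * v₃ 1 - v₂ 1 * v₃ 0) ^ 2) * X ^ (d₂ + d₃) := by
  rw [Matrix.det_fin_two, Matrix.det_fin_two]
  simp only [Matrix.add_apply, Matrix.smul_apply, Matrix.map_apply, Matrix.vecMulVec_apply, smul_eq_mul,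
    Polynomial.C_mul, Polynomial.C_sub, Polynomial.C_add, Polynomial.C_pow]
  ring

/-- The same expansion as a `Fin 11`-indexed fewnomial (the form the kill engine consumes). [folklore] -/
theorem det_rankOne_four_sum (e d₀ d₁ d₂ d₃ : ℕ) (J : Matrix (Fin 2) (Fin 2) ℝ) (v₀ v₁ v₂ v₃ : Fin 2 → ℝ) (w₀ w₁ w₂ w₃ : ℝ) :
    Matrix.det (((X : ℝ[X]) ^ e) • J.map Polynomial.C
        + (Polynomial.C w₀ * X ^ d₀) • (vecMulVec v₀ v₀).map Polynomial.C
        + (Polynomial.C w₁ * X ^ d₁) • (vecMulVec v₁ v₁).map Polynomial.C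
        + (Polynomial.C w₂ * X ^ d₂) • (vecMulVec v₂ v₂).map Polynomial.C
        + (Polynomial.C w₃ * X ^ d₃) • (vecMulVec v₃ v₃).map Polynomial.C)
      = ∑ i : Fin 11, Polynomial.C ((![J.det, w₀ * (J 0 0 * v₀ 1 ^ 2 + J 1 1 * v₀ 0 ^ 2 - (J 0 1 + J 1 0) * (v₀ 0 * v₀ 1)), w₁ * (J 0 0 * v₁ 1 ^ 2 + J 1 1 * v₁ 0 ^ 2 - (J 0 1 + J 1 0) * (v₁ 0 * v₁ 1)), w₂ * (J 0 0 * v₂ 1 ^ 2 + J 1 1 * v₂ 0 ^ 2 - (J 0 1 + J 1 0) * (v₂ 0 * v₂ 1)), w₃ * (J 0 0 * v₃ 1 ^ 2 + J 1 1 * v₃ 0 ^ 2 - (J 0 1 + J 1 0) * (v₃ 0 * v₃ 1)), w₀ * w₁ * ((v₀ 0 * v₁ 1 - v₀ 1 * v₁ 0) ^ 2), w₀ * w₂ * ((v₀ 0 * v₂ 1 - v₀ 1 * v₂ 0) ^ 2), w₀ * w₃ * ((v₀ 0 * v₃ 1 - v₀ 1 * v₃ 0) ^ 2), w₁ * w₂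 * ((v₁ 0 * v₂ 1 - v₁ 1 * v₂ 0) ^ 2), w₁ * w₃ * ((v₁ 0 * v₃ 1 - v₁ 1 * v₃ 0) ^ 2), w₂ * w₃ * ((v₂ 0 * v₃ 1 - v₂ 1 * v₃ 0) ^ 2)] : Fin 11 → ℝ) i) * X ^ ((![2 * e, e + d₀, e + d₁, e + d₂, e + d₃, d₀ + d₁, d₀ + d₂, d₀ + d₃, d₁ + d₂, d₁ + d₃, d₂ + d₃] : Fin 11 → ℕ) i) := by
  rw [det_rankOne_four]
  simp only [Fin.sum_univ_succ, Fin.sum_univ_zero, Matrix.cons_val_zero, Matrix.cons_val_succ]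
  ring

/-- **The eleven-nomial under `d₀ + d₂ < e + d₁` and condition (S) has at most eight positive roots** (real-parameter form: `m₁, m₃ < 0` the
pairings of letters `1, 3` with the pivot, `D01 = Δ₀₁², D03 = Δ₀₃² > 0`, the other data arbitrary; weights `w₀, w₁, w₃ > 0`). -/
theorem elevenNomial_chamberB_le_eight (e d₀ d₁ d₂ d₃ : ℕ) (h01 : d₀ < d₁) (h1e : d₁ < e) (he2 : e < d₂) (h23 : d₂ < d₃)
    (hB1 : d₀ + d₂ < e + d₁)
    (dJ m₀ m₁ m₂ m₃ w₀ w₁ w₂ w₃ D01 D02 D03 D12 D13 D23 : ℝ) (hw₀ : 0 < w₀) (hw₁ : 0 < w₁) (hw₃ : 0 < w₃)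
    (hm₁ : m₁ < 0) (hm₃ : m₃ < 0)
    (hS : (-m₁) * D03
        * (((d₁ : ℝ) - d₀) * ((e : ℝ) + d₁ - d₀ - d₂) * ((d₂ : ℝ) - e) * ((e : ℝ) - d₁) * ((d₂ : ℝ) - d₁) * ((d₃ : ℝ) - e)
            * ((d₂ : ℝ) + d₃ - e - d₁))
        * (((d₃ : ℝ) - e) * ((d₃ : ℝ) - d₂) * ((d₀ : ℝ) + d₃ - d₁ - d₂) * ((d₀ : ℝ) + d₃ - 2 * e) * ((e : ℝ) + d₂ - d₀ - d₃)
            * ((d₁ : ℝ) - d₀) * ((d₂ : ℝ) - d₀))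
        ≤ (-m₃) * D01
        * (((2 : ℝ) * e - d₀ - d₁) * ((e : ℝ) - d₁) * ((e : ℝ) + d₂ - d₀ - d₁) * ((d₂ : ℝ) - d₁) * ((d₂ : ℝ) - d₀) * ((d₃ : ℝ) - d₀)
            * ((d₂ : ℝ) + d₃ - d₀ - d₁))
        * (((e : ℝ) + d₃ - e - d₀) * ((d₃ : ℝ) - d₂ + e - d₀) * ((d₃ : ℝ) - d₂ + e - d₁) * ((d₃ : ℝ) - e) * ((d₃ : ℝ) - d₂)
            * ((e : ℝ) - d₁) * ((d₂ : ℝ) - e))) :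
    ((∑ i : Fin 11, Polynomial.C ((![dJ, w₀ * m₀, w₁ * m₁, w₂ * m₂, w₃ * m₃, w₀ * w₁ * D01, w₀ * w₂ * D02, w₀ * w₃ * D03, w₁ * w₂ * D12, w₁ * w₃ * D13, w₂ * w₃ * D23] : Fin 11 → ℝ) i) * X ^ ((![2 * e, e + d₀, e + d₁, e + d₂, e + d₃, d₀ + d₁, d₀ + d₂, d₀ + d₃, d₁ + d₂, d₁ + d₃, d₂ + d₃] : Fin 11 → ℕ) i)).roots.toFinset.filter (fun t => 0 < t)).card ≤ 8 := by
  classical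
  have h01' : (d₀ : ℝ) < d₁ := by exact_mod_cast h01
  have h1e' : (d₁ : ℝ) < e := by exact_mod_cast h1e
  have he2' : (e : ℝ) < d₂ := by exact_mod_cast he2
  have h23' : (d₂ : ℝ) < d₃ := by exact_mod_cast h23
  have hB1' : (d₀ : ℝ) + d₂ < e + d₁ := by exact_mod_cast hB1
  -- the four distance products (positive atoms)
  obtain ⟨PA, hPA⟩ : ∃ x : ℝ, x = ((2 : ℝ) * e - d₀ - d₁) * ((e : ℝ) - d₁) * ((e : ℝ) + d₂ - d₀ - d₁) * ((d₂ : ℝ) - d₁)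
      * ((d₂ : ℝ) - d₀) * ((d₃ : ℝ) - d₀) * ((d₂ : ℝ) + d₃ - d₀ - d₁) := ⟨_, rfl⟩
  obtain ⟨PB, hPB⟩ : ∃ x : ℝ, x = ((d₁ : ℝ) - d₀) * ((e : ℝ) + d₁ - d₀ - d₂) * ((d₂ : ℝ) - e) * ((e : ℝ) - d₁) * ((d₂ : ℝ) - d₁)
      * ((d₃ : ℝ) - e) * ((d₂ : ℝ) + d₃ - e - d₁) := ⟨_, rfl⟩
  obtain ⟨PC, hPC⟩ : ∃ x : ℝ, x = ((d₃ : ℝ) - e) * ((d₃ : ℝ) - d₂) * ((d₀ : ℝ) + d₃ - d₁ - d₂) * ((d₀ : ℝ) + d₃ - 2 * e)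
      * ((e : ℝ) + d₂ - d₀ - d₃) * ((d₁ : ℝ) - d₀) * ((d₂ : ℝ) - d₀) := ⟨_, rfl⟩
  obtain ⟨PD, hPD⟩ : ∃ x : ℝ, x = ((e : ℝ) + d₃ - e - d₀) * ((d₃ : ℝ) - d₂ + e - d₀) * ((d₃ : ℝ) - d₂ + e - d₁) * ((d₃ : ℝ) - e)
      * ((d₃ : ℝ) - d₂) * ((e : ℝ) - d₁) * ((d₂ : ℝ) - e) := ⟨_, rfl⟩
  have hS' : (-m₁) * D03 * PB * PC ≤ (-m₃) * D01 * PA * PD := by rw [hPA, hPB, hPC, hPD]; exact hS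
  clear hS
  have hPBp : 0 < PB := by
    rw [hPB]
    have f1 : 0 < (d₁ : ℝ) - d₀ := by linarith
    have f2 : 0 < (e : ℝ) + d₁ - d₀ - d₂ := by linarith
    have f3 : 0 < (d₂ : ℝ) - e := by linarith
    have f4 : 0 < (e : ℝ) - d₁ := by linarith
    have f5 : 0 < (d₂ : ℝ) - d₁ := by linarith
    have f6 : 0 < (d₃ : ℝ) - e := by linarith
    have f7 : 0 < (d₂ : ℝ) + d₃ - e - d₁ := by linarith
    exact mul_pos (mul_pos (mul_pos (mul_pos (mul_pos (mul_pos f1 f2) f3) f4) f5) f6) f7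
  have hPDp : 0 < PD := by
    rw [hPD]
    have f1 : 0 < (e : ℝ) + d₃ - e - d₀ := by linarith
    have f2 : 0 < (d₃ : ℝ) - d₂ + e - d₀ := by linarith
    have f3 : 0 < (d₃ : ℝ) - d₂ + e - d₁ := by linarith
    have f4 : 0 < (d₃ : ℝ) - e := by linarith
    have f5 : 0 < (d₃ : ℝ) - d₂ := by linarith
    have f6 : 0 < (e : ℝ) - d₁ := by linarith
    have f7 : 0 < (d₂ : ℝ) - e := by linarith
    exact mul_pos (mul_pos (mul_pos (mul_pos (mul_pos (mul_pos f1 f2) f3) f4) f5) f6) f7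
  -- the four surviving coefficients
  obtain ⟨A, hA⟩ : ∃ x : ℝ, x = w₀ * w₁ * D01 * PA := ⟨_, rfl⟩
  obtain ⟨B, hB⟩ : ∃ x : ℝ, x = w₁ * (-m₁) * PB := ⟨_, rfl⟩
  obtain ⟨C, hC⟩ : ∃ x : ℝ, x = w₀ * w₃ * D03 * PC := ⟨_, rfl⟩
  obtain ⟨D, hD⟩ : ∃ x : ℝ, x = w₃ * (-m₃) * PD := ⟨_, rfl⟩
  have hBp : 0 < B := by rw [hB]; exact mul_pos (mul_pos hw₁ (by linarith)) hPBp
  have hDp : 0 < D := by rw [hD]; exact mul_pos (mul_pos hw₃ (by linarith)) hPDp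
  have hBC : B * C ≤ A * D := by
    have e1 : B * C = (w₀ * w₁ * w₃) * ((-m₁) * D03 * PB * PC) := by rw [hB, hC]; ring
    have e2 : A * D = (w₀ * w₁ * w₃) * ((-m₃) * D01 * PA * PD) := by rw [hA, hD]; ring
    rw [e1, e2]
    exact mul_le_mul_of_nonneg_left hS' (mul_pos (mul_pos hw₀ hw₁) hw₃).le
  -- seven kills
  have hkills := card_posRoots_le_kills (Finset.univ : Finset (Fin 11)) (![2 * e, e + d₀, e + d₁, e + d₂, e + d₃, d₀ + d₁, d₀ + d₂, d₀ + d₃, d₁ + d₂, d₁ + d₃, d₂ + d₃] : Fin 11 → ℕ) [2 * e, e + d₀, e + d₂, d₀ + d₂, d₁ + d₂, d₁ + d₃, d₂ + d₃] (![dJ, w₀ * m₀, w₁ * m₁, w₂ * m₂, w₃ * m₃, w₀ * w₁ * D01, w₀ * w₂ * D02, w₀ * w₃ * D03, w₁ * w₂ * D12, w₁ * w₃ * D13, w₂ * w₃ * D23] : Fin 11 → ℝ)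
  -- the killed eleven-nomial is MINUS the four-nomial `A X^{d₀+d₁} − B X^{e+d₁} + C X^{d₀+d₃} − D X^{e+d₃}`
  have hfour : (∑ i ∈ (Finset.univ : Finset (Fin 11)), Polynomial.C ((![dJ, w₀ * m₀, w₁ * m₁, w₂ * m₂, w₃ * m₃, w₀ * w₁ * D01, w₀ * w₂ * D02, w₀ * w₃ * D03, w₁ * w₂ * D12, w₁ * w₃ * D13, w₂ * w₃ * D23] : Fin 11 → ℝ) i
          * (([2 * e, e + d₀, e + d₂, d₀ + d₂, d₁ + d₂, d₁ + d₃, d₂ + d₃]).map (fun ρ : ℕ => ((((![2 * e, e + d₀, e + d₁, e + d₂, e + d₃, d₀ + d₁, d₀ + d₂, d₀ + d₃, d₁ + d₂, d₁ + d₃, d₂ + d₃] : Fin 11 → ℕ) i : ℕ) : ℝ) - (ρ : ℝ)))).prod) * X ^ ((![2 * e, e + d₀, e + d₁, e + d₂, e + d₃, d₀ + d₁, d₀ + d₂, d₀ + d₃, d₁ + d₂, d₁ + d₃, d₂ + d₃] : Fin 11 → ℕ) i))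
      = -(Polynomial.C A * X ^ (d₀ + d₁) - Polynomial.C B * X ^ (d₀ + d₁ + (e - d₀))
          + Polynomial.C C * X ^ (d₀ + d₁ + (d₃ - d₁)) - Polynomial.C D * X ^ (d₀ + d₁ + (e - d₀) + (d₃ - d₁))) := by
    have e3 : d₀ + d₁ + (e - d₀) + (d₃ - d₁) = e + d₃ := by omega
    have e1 : d₀ + d₁ + (e - d₀) = e + d₁ := by omega
    have e2 : d₀ + d₁ + (d₃ - d₁) = d₀ + d₃ := by omega
    rw [e3, e1, e2]
    have hcoef : ∀ i : Fin 11, (![dJ, w₀ * m₀, w₁ * m₁, w₂ * m₂, w₃ * m₃, w₀ * w₁ * D01, w₀ * w₂ * D02, w₀ * w₃ * D03, w₁ * w₂ * D12, w₁ * w₃ * D13, w₂ * w₃ * D23] : Fin 11 → ℝ) i * (([2 * e, e + d₀, e + d₂, d₀ + d₂, d₁ + d₂, d₁ + d₃, d₂ + d₃]).map (fun ρ : ℕ => ((((![2 * e, e + d₀, e + d₁, e + d₂, e + d₃, d₀ + d₁, d₀ + d₂, d₀ + d₃, d₁ + d₂, d₁ + d₃, d₂ + d₃] : Fin 11 → ℕ)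 i : ℕ) : ℝ) - (ρ : ℝ)))).prod
        = (![0, 0, B, 0, D, -A, 0, -C, 0, 0, 0] : Fin 11 → ℝ) i := by
      intro i
      fin_cases i <;>
        simp only [Fin.zero_eta, Fin.mk_one, Fin.isValue, Matrix.cons_val_zero, Matrix.cons_val_one,
          List.map_cons, List.map_nil, List.prod_cons, List.prod_nil, hA, hB, hC, hD, hPA, hPB, hPC, hPD] <;>
        push_cast <;> ring
    rw [Finset.sum_congr rfl (fun i _ => by rw [hcoef i])]
    simp only [Fin.sum_univ_succ, Fin.sum_univ_zero, Matrix.cons_val_zero, Matrix.cons_val_succ, map_zero, zero_mul,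
      zero_add, add_zero, Polynomial.C_neg]
    ring
  rw [hfour, Polynomial.roots_neg] at hkills
  have hone := card_posRoots_fourNomial_le_one A B C D hBp hDp hBC (d₀ + d₁) (e - d₀) (d₃ - d₁) (by omega)
  simp only [List.length_cons, List.length_nil] at hkills
  omega

/-- **RANK-ONE `(2,4)₁` WITH `d₀ + d₂ < e + d₁` (e.g. chamber (B)): `Z₊ ≤ 8` under the angular condition (S)** (matrix form; `J` arbitrary, letters `wₖvₖvₖᵀ` with
`wₖ > 0`, letters `1, 3` pairing negatively with `J`; see the module docstring for (S) and its scope). [this file] -/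
theorem chamberB_rankOne_posRoots_le_eight (e d₀ d₁ d₂ d₃ : ℕ) (h01 : d₀ < d₁) (h1e : d₁ < e) (he2 : e < d₂) (h23 : d₂ < d₃)
    (hB1 : d₀ + d₂ < e + d₁)
    (J : Matrix (Fin 2) (Fin 2) ℝ) (v₀ v₁ v₂ v₃ : Fin 2 → ℝ) (w₀ w₁ w₂ w₃ : ℝ) (hw₀ : 0 < w₀) (hw₁ : 0 < w₁) (hw₃ : 0 < w₃)
    (hm₁ : (J 0 0 * v₁ 1 ^ 2 + J 1 1 * v₁ 0 ^ 2 - (J 0 1 + J 1 0) * (v₁ 0 * v₁ 1)) < 0) (hm₃ : (J 0 0 * v₃ 1 ^ 2 + J 1 1 * v₃ 0 ^ 2 - (J 0 1 + J 1 0) * (v₃ 0 * v₃ 1)) < 0)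
    (hS : (-(J 0 0 * v₁ 1 ^ 2 + J 1 1 * v₁ 0 ^ 2 - (J 0 1 + J 1 0) * (v₁ 0 * v₁ 1))) * ((v₀ 0 * v₃ 1 - v₀ 1 * v₃ 0) ^ 2)
        * (((d₁ : ℝ) - d₀) * ((e : ℝ) + d₁ - d₀ - d₂) * ((d₂ : ℝ) - e) * ((e : ℝ) - d₁) * ((d₂ : ℝ) - d₁) * ((d₃ : ℝ) - e)
            * ((d₂ : ℝ) + d₃ - e - d₁))
        * (((d₃ : ℝ) - e) * ((d₃ : ℝ) - d₂) * ((d₀ : ℝ) + d₃ - d₁ - d₂) * ((d₀ : ℝ) + d₃ - 2 * e) * ((e : ℝ) + d₂ - d₀ - d₃)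
            * ((d₁ : ℝ) - d₀) * ((d₂ : ℝ) - d₀))
        ≤ (-(J 0 0 * v₃ 1 ^ 2 + J 1 1 * v₃ 0 ^ 2 - (J 0 1 + J 1 0) * (v₃ 0 * v₃ 1))) * ((v₀ 0 * v₁ 1 - v₀ 1 * v₁ 0) ^ 2)
        * (((2 : ℝ) * e - d₀ - d₁) * ((e : ℝ) - d₁) * ((e : ℝ) + d₂ - d₀ - d₁) * ((d₂ : ℝ) - d₁) * ((d₂ : ℝ) - d₀) * ((d₃ : ℝ) - d₀)
            * ((d₂ : ℝ) + d₃ - d₀ - d₁))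
        * (((e : ℝ) + d₃ - e - d₀) * ((d₃ : ℝ) - d₂ + e - d₀) * ((d₃ : ℝ) - d₂ + e - d₁) * ((d₃ : ℝ) - e) * ((d₃ : ℝ) - d₂)
            * ((e : ℝ) - d₁) * ((d₂ : ℝ) - e))) :
    ((Matrix.det (((X : ℝ[X]) ^ e) • J.map Polynomial.C
        + (Polynomial.C w₀ * X ^ d₀) • (vecMulVec v₀ v₀).map Polynomial.C
        + (Polynomial.C w₁ * X ^ d₁) • (vecMulVec v₁ v₁).map Polynomial.C
        + (Polynomial.C w₂ * X ^ d₂) • (vecMulVec v₂ v₂).map Polynomial.C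
        + (Polynomial.C w₃ * X ^ d₃) • (vecMulVec v₃ v₃).map Polynomial.C)).roots.toFinset.filter (fun t => 0 < t)).card
      ≤ 8 := by
  rw [det_rankOne_four_sum]
  exact elevenNomial_chamberB_le_eight e d₀ d₁ d₂ d₃ h01 h1e he2 h23 hB1 J.det _ _ _ _ w₀ w₁ w₂ w₃ _ _ _ _ _ _
    hw₀ hw₁ hw₃ hm₁ hm₃ hS

end Summit.ValiantsHypothesis.ValiantsHypothesis.Theorems.LacunarySymmetroidMatrixDescartes.Pivot.TwoDirections.BlockLaw
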